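import Mathlib
import Summits.NavierStokesRegularity.NavierStokesRegularity.Theorems.EulerZoomLiouvillePowerGaugeEulerLiouvilleWindowFlux
import Summits.NavierStokesRegularity.NavierStokesRegularity.Theorems.EulerZoomLiouvillePowerGaugeEulerLiouvillePressureSplitWindow
import HarnessLib

/-!
# One-ball window flux bound at the CUBIC rate `a^{3/2 − 9ρ/4}` via the local pressure splitting
# (crux `EulerZoomLiouville.PowerGaugeEulerLiouville` = stmt-NavierStokesRegularity-19832, lead's line `birth`)

Route `EulerZoomLiouville` (NavierStokesRegularity).  Third brick of the sharper pressure route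
(`…PressureSplitSlice` → `…PressureSplitWindow` → here): for a member of Seregin's power-gauged class, the flux
mass on one ball and one window obeys, for `a ≥ 1`, `−a² ≤ α < β ≤ 0`,

  `∫∫_{(α,β)×B_a} (|u|³ + 2|p||u|) ≤ M · a^{3/2 − 9ρ/4}`   (`M = M(c, β−α)`, `exists_onePall_window_le_split`),

i.e. the PRESSURE FLUX NOW HAS THE CUBIC RATE (compare `…WindowFluxBounds.exists_lintegral_cube_add_pressure_window_le`:
`K₃ a^{3/2−9ρ/4} + K₄ a^{11/6−25ρ/12}`).  Ingredients: the window cubic bound on `B_a` and `B_{2a}`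
(`exists_lintegral_cube_window_ball_le_rpow`), the `A`-gauge slice bound `∫_{B_a}|u(t)| ≤ |B_a|^{1/2}(c a^{1−2ρ})^{1/2}`,
the `D`-gauge in `L¹` form `∫∫_{(α,β)×B_{2a}}|p| ≤ |(α,β)×B_{2a}|^{1/3} (c (2a)^{2−2ρ})^{2/3}`, the window pressure bound
`exists_lintegral_pressure_velocity_window_le_split` at `r = 2a`, and the exponent bookkeeping
`a^{4/3−7ρ/3}, a^{1−5ρ/2} ≤ a^{3/2−9ρ/4}` (`a ≥ 1`, `ρ ≥ 0`).  Consequence (next file): window flux integrability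
and all flux strata of the open core for `ρ > 2/9` instead of `ρ > 2/5`.  WHAT THIS IS NOT: not NS, not the open
core; a helper `--supports` stmt-19832. [folklore]
-/

noncomputable section

set_option linter.dupNamespace false

open MeasureTheory Set Filter Topology Metric Function TopologicalSpace
open scoped ENNReal NNReal

namespace Summit.NavierStokesRegularity.NavierStokesRegularity.Theorems.PowerGaugeEulerLiouville

open Literature.Analysis Literature.Analysis.FunctionSpaces Literature.Analysis.FluidPDE

/-! ## Exponent bookkeeping (`a ≥ 1`, `ρ ≥ 0`) -/

/-- `a⁻³ · (a³)^{1/2} (a^{1−2ρ})^{1/2} · (a³)^{1/3} (a^{2−2ρ})^{2/3} = a^{4/3 − 7ρ/3} ≤ a^{3/2 − 9ρ/4}`. [folklore] -/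
theorem rpow_harmonic_term_le {a ρ : ℝ} (ha : 1 ≤ a) (hρ : 0 ≤ ρ) :
    (a ^ 3)⁻¹ * ((a ^ 3) ^ (1 / 2 : ℝ) * (a ^ (1 - 2 * ρ)) ^ (1 / 2 : ℝ)) *
        ((a ^ 3) ^ (1 / 3 : ℝ) * (a ^ (2 - 2 * ρ)) ^ (2 / 3 : ℝ)) ≤ a ^ (3 / 2 - 9 * ρ / 4) := by
  have ha0 : 0 < a := lt_of_lt_of_le one_pos ha
  have h3 : (a ^ 3 : ℝ) = a ^ (3 : ℝ) := by rw [← Real.rpow_natCast]; norm_num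
  rw [h3, ← Real.rpow_neg_one (a ^ (3 : ℝ)), ← Real.rpow_mul ha0.le, ← Real.rpow_mul ha0.le,
    ← Real.rpow_mul ha0.le, ← Real.rpow_mul ha0.le, ← Real.rpow_mul ha0.le,
    ← Real.rpow_add ha0, ← Real.rpow_add ha0, ← Real.rpow_add ha0, ← Real.rpow_add ha0]
  refine Real.rpow_le_rpow_of_exponent_le ha ?_
  nlinarith

/-- `a⁻³ · (a³)^{1/2} (a^{1−2ρ})^{1/2} · a · (a^{3/2−9ρ/4})^{2/3} = a^{1 − 5ρ/2} ≤ a^{3/2 − 9ρ/4}`. [folklore] -/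
theorem rpow_cubic_term_le {a ρ : ℝ} (ha : 1 ≤ a) (hρ : 0 ≤ ρ) :
    (a ^ 3)⁻¹ * ((a ^ 3) ^ (1 / 2 : ℝ) * (a ^ (1 - 2 * ρ)) ^ (1 / 2 : ℝ)) *
        (a * (a ^ (3 / 2 - 9 * ρ / 4)) ^ (2 / 3 : ℝ)) ≤ a ^ (3 / 2 - 9 * ρ / 4) := by
  have ha0 : 0 < a := lt_of_lt_of_le one_pos ha
  have h3 : (a ^ 3 : ℝ) = a ^ (3 : ℝ) := by rw [← Real.rpow_natCast]; norm_num
  have h1 : ∀ e : ℝ, a * a ^ e = a ^ (1 + e) := fun e => by rw [Real.rpow_add ha0, Real.rpow_one]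
  rw [h3, ← Real.rpow_neg_one (a ^ (3 : ℝ)), ← Real.rpow_mul ha0.le, ← Real.rpow_mul ha0.le,
    ← Real.rpow_mul ha0.le, ← Real.rpow_mul ha0.le, h1, ← Real.rpow_add ha0, ← Real.rpow_add ha0,
    ← Real.rpow_add ha0]
  refine Real.rpow_le_rpow_of_exponent_le ha ?_
  nlinarith


/-! ## The one-ball flux mass at the cubic rate -/

/-- Cauchy–Schwarz for lower integrals on a set of finite measure, without measurability:
`∫_s f ≤ (∫_s f²)^{1/2} |s|^{1/2}` (pass to a measurable minorant with the same integral). [folklore] -/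
theorem setLIntegral_le_sqrt_mul_sqrt {X : Type*} [MeasurableSpace X] (μ : Measure X) (s : Set X)
    (f : X → ℝ≥0∞) :
    ∫⁻ x in s, f x ∂μ ≤ (∫⁻ x in s, f x ^ 2 ∂μ) ^ (1 / 2 : ℝ) * (μ s) ^ (1 / 2 : ℝ) := by
  obtain ⟨g, hgm, hgle, hgeq⟩ := exists_measurable_le_lintegral_eq (μ.restrict s) f
  rw [hgeq]
  have hpq : Real.HolderConjugate (2 : ℝ) 2 := ⟨by norm_num, by norm_num, by norm_num⟩
  have hcs := ENNReal.lintegral_mul_le_Lp_mul_Lq (μ.restrict s) hpq hgm.aemeasurable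
    (aemeasurable_const (b := (1 : ℝ≥0∞)))
  simp only [Pi.mul_apply, mul_one, ENNReal.one_rpow, lintegral_const, one_mul,
    Measure.restrict_apply_univ] at hcs
  refine hcs.trans ?_
  have e2 : ∀ y : ℝ≥0∞, y ^ (2 : ℝ) = y ^ (2 : ℕ) := fun y => by
    rw [show (2 : ℝ) = ((2 : ℕ) : ℝ) by norm_num, ENNReal.rpow_natCast]
  simp_rw [e2]
  gcongr with x
  exact hgle x

/-- **One-ball window flux mass at the cubic rate `a^{3/2−9ρ/4}`.**  For a member of the power-gauged class
(`ρ ≥ 0`) and a window `α < β ≤ 0` there is `M = M(c, β−α) ≥ 0` with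
`∫∫_{(α,β)×B_a} (|u|³ + 2|p||u|) ≤ M a^{3/2−9ρ/4}` for every `a ≥ 1` with `−a² ≤ α`: the cubic part by
`exists_lintegral_cube_window_ball_le_rpow`, the pressure part by the local pressure splitting
(`exists_lintegral_pressure_velocity_window_le_split` at `r = 2a`, the `A`-gauge slice bound and the
`D`-gauge in `L¹` form), the two pressure remainders folded into the cubic rate by `rpow_harmonic_term_le`,
`rpow_cubic_term_le`. [folklore] -/
theorem exists_oneBall_window_le_split {ρ : ℝ} (hρ : 0 ≤ ρ)
    {u : ℝ → EuclideanSpace ℝ (Fin 3) → EuclideanSpace ℝ (Fin 3)} {p : ℝ → EuclideanSpace ℝ (Fin 3) → ℝ}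
    {H : ℝ → EuclideanSpace ℝ (Fin 3) → EuclideanSpace ℝ (Fin 3) →L[ℝ] EuclideanSpace ℝ (Fin 3)} {c : ℝ≥0}
    (hsw : IsSuitableWeakSolutionOn (slab (EuclideanSpace ℝ (Fin 3)) (Iio 0) isOpen_Iio) 0 0 u p)
    (hH : HasWeakSpatialGradientOn (slab (EuclideanSpace ℝ (Fin 3)) (Iio 0) isOpen_Iio) u H)
    (hc : ∀ a : ℝ, 0 < a → ENNReal.ofReal (a ^ (2 * ρ)) * cknA a (0 : ℝ × EuclideanSpace ℝ (Fin 3)) u +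
        ENNReal.ofReal (a ^ ρ) * cknE a (0 : ℝ × EuclideanSpace ℝ (Fin 3)) H +
        ENNReal.ofReal (a ^ (2 * ρ)) * cknD a (0 : ℝ × EuclideanSpace ℝ (Fin 3)) p ≤ (c : ℝ≥0∞))
    {α β : ℝ} (hαβ : α < β) (hβ : β ≤ 0) :
    ∃ M : ℝ, 0 ≤ M ∧ ∀ a : ℝ, 1 ≤ a → -(a ^ 2) ≤ α →
      ∫⁻ z in Ioo α β ×ˢ ball (0 : EuclideanSpace ℝ (Fin 3)) a,
          (‖u z.1 z.2‖ₑ ^ (3 : ℕ) + 2 * (‖p z.1 z.2‖ₑ * ‖u z.1 z.2‖ₑ)) ≤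
        ENNReal.ofReal (M * a ^ (3 / 2 - 9 * ρ / 4)) := by
  obtain ⟨Kc, hKc0, hKc⟩ := exists_lintegral_cube_window_ball_le_rpow
  obtain ⟨c₅, hc₅⟩ := exists_lintegral_pressure_velocity_window_le_split
  have hL : 0 < β - α := by linarith
  set L : ℝ := β - α with hLdef
  -- gauge components
  have hA : ∀ a : ℝ, 0 < a →
      ENNReal.ofReal (a ^ (2 * ρ)) * cknA a (0 : ℝ × EuclideanSpace ℝ (Fin 3)) u ≤ (c : ℝ≥0∞) :=
    fun a ha => le_trans (le_trans le_self_add le_self_add) (hc a ha)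
  have hE : ∀ a : ℝ, 0 < a →
      ENNReal.ofReal (a ^ ρ) * cknE a (0 : ℝ × EuclideanSpace ℝ (Fin 3)) H ≤ (c : ℝ≥0∞) :=
    fun a ha => le_trans (le_trans le_add_self le_self_add) (hc a ha)
  have hD : ∀ a : ℝ, 0 < a →
      ENNReal.ofReal (a ^ (2 * ρ)) * cknD a (0 : ℝ × EuclideanSpace ℝ (Fin 3)) p ≤ (c : ℝ≥0∞) :=
    fun a ha => le_trans le_add_self (hc a ha)
  have hAs := hasScaledLocalEnergyBound_of_gaugeA (ρ := ρ) hA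
  have hum : AEStronglyMeasurable (uncurry u)
      (volume.restrict (Iio (0 : ℝ) ×ˢ (univ : Set (EuclideanSpace ℝ (Fin 3))))) := by
    have := hH.locallyIntegrableOn.aestronglyMeasurable
    simpa [slab] using this
  have hpm : AEStronglyMeasurable (uncurry p)
      (volume.restrict (Iio (0 : ℝ) ×ˢ (univ : Set (EuclideanSpace ℝ (Fin 3))))) := by
    have := hsw.distributional.2.2.1.aestronglyMeasurable
    simpa [slab] using this
  -- the constants
  set V₁ : ℝ≥0∞ := volume (ball (0 : EuclideanSpace ℝ (Fin 3)) 1) with hV₁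
  have hV₁t : V₁ ≠ ⊤ := measure_ball_lt_top.ne
  set X₁ : ℝ := Kc * (c : ℝ) ^ (3 / 2 : ℝ) * (L ^ (1 / 4 : ℝ) + L) with hX₁
  have hX₁0 : 0 ≤ X₁ := by positivity
  set X₂ : ℝ≥0∞ := ENNReal.ofReal X₁ * ENNReal.ofReal ((2 : ℝ) ^ (3 / 2 : ℝ)) with hX₂
  have hX₂t : X₂ ≠ ⊤ := ENNReal.mul_ne_top ENNReal.ofReal_ne_top ENNReal.ofReal_ne_top
  set Sc : ℝ≥0∞ := ENNReal.ofReal (c : ℝ) ^ (1 / 2 : ℝ) * V₁ ^ (1 / 2 : ℝ) with hSc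
  have hSct : Sc ≠ ⊤ := ENNReal.mul_ne_top (ENNReal.rpow_ne_top_of_nonneg (by norm_num) ENNReal.ofReal_ne_top)
    (ENNReal.rpow_ne_top_of_nonneg (by norm_num) hV₁t)
  set X₄ : ℝ≥0∞ := ENNReal.ofReal ((c : ℝ) * 4) ^ (2 / 3 : ℝ) *
    (ENNReal.ofReal L * ENNReal.ofReal 8 * V₁) ^ (1 / 3 : ℝ) with hX₄
  have hX₄t : X₄ ≠ ⊤ := ENNReal.mul_ne_top (ENNReal.rpow_ne_top_of_nonneg (by norm_num) ENNReal.ofReal_ne_top)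
    (ENNReal.rpow_ne_top_of_nonneg (by norm_num)
      (ENNReal.mul_ne_top (ENNReal.mul_ne_top ENNReal.ofReal_ne_top ENNReal.ofReal_ne_top) hV₁t))
  set X₅ : ℝ≥0∞ := Sc * (ENNReal.ofReal 2 * ENNReal.ofReal L ^ (1 / 3 : ℝ) * X₂ ^ (2 / 3 : ℝ)) with hX₅
  have hX₅t : X₅ ≠ ⊤ := ENNReal.mul_ne_top hSct (ENNReal.mul_ne_top
    (ENNReal.mul_ne_top ENNReal.ofReal_ne_top (ENNReal.rpow_ne_top_of_nonneg (by norm_num) ENNReal.ofReal_ne_top))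
    (ENNReal.rpow_ne_top_of_nonneg (by norm_num) hX₂t))
  set Γ : ℝ≥0∞ := ENNReal.ofReal X₁ + 2 * ((c₅ : ℝ≥0∞) * (X₂ + Sc * X₄ + X₅)) with hΓ
  have hΓt : Γ ≠ ⊤ := ENNReal.add_ne_top.2 ⟨ENNReal.ofReal_ne_top, ENNReal.mul_ne_top (by norm_num)
    (ENNReal.mul_ne_top ENNReal.coe_ne_top (ENNReal.add_ne_top.2 ⟨ENNReal.add_ne_top.2
      ⟨hX₂t, ENNReal.mul_ne_top hSct hX₄t⟩, hX₅t⟩))⟩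
  refine ⟨Γ.toReal, ENNReal.toReal_nonneg, fun a ha hα => ?_⟩
  have ha0 : 0 < a := lt_of_lt_of_le one_pos ha
  have h2a1 : 1 ≤ 2 * a := by linarith
  have h2a0 : 0 < 2 * a := by linarith
  have hα2 : -((2 * a) ^ 2) ≤ α := by nlinarith
  set s₁ : ℝ := 3 / 2 - 9 * ρ / 4 with hs₁
  have hs₁le : s₁ ≤ 3 / 2 := by rw [hs₁]; linarith
  set A₁ : ℝ≥0∞ := ENNReal.ofReal (a ^ s₁) with hA₁
  have has₁ : 0 ≤ a ^ s₁ := Real.rpow_nonneg ha0.le _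
  set W : Set ℝ := Ioo α β with hW
  -- ## (1) the cubic mass on `B_a`
  have h1 : ∫⁻ z in W ×ˢ ball (0 : EuclideanSpace ℝ (Fin 3)) a, ‖u z.1 z.2‖ₑ ^ (3 : ℕ) ≤
      ENNReal.ofReal X₁ * A₁ := by
    have h := hKc ρ hρ u H c hH hA hE a α β ha hα hαβ hβ
    rw [hA₁, ← ENNReal.ofReal_mul hX₁0]
    exact h
  -- ## (2) the cubic mass on `B_{2a}`
  set Iu : ℝ≥0∞ := ∫⁻ z in W ×ˢ ball (0 : EuclideanSpace ℝ (Fin 3)) (2 * a), ‖u z.1 z.2‖ₑ ^ (3 : ℕ) with hIu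
  have h2 : Iu ≤ X₂ * A₁ := by
    have h := hKc ρ hρ u H c hH hA hE (2 * a) α β h2a1 hα2 hαβ hβ
    rw [← hLdef, ← hX₁] at h
    refine h.trans ?_
    have hreal : X₁ * (2 * a) ^ s₁ ≤ X₁ * (2 ^ (3 / 2 : ℝ) * a ^ s₁) := by
      refine mul_le_mul_of_nonneg_left ?_ hX₁0
      rw [Real.mul_rpow (by norm_num) ha0.le]
      exact mul_le_mul_of_nonneg_right (Real.rpow_le_rpow_of_exponent_le (by norm_num) hs₁le) has₁
    calc ENNReal.ofReal (X₁ * (2 * a) ^ s₁) ≤ ENNReal.ofReal (X₁ * (2 ^ (3 / 2 : ℝ) * a ^ s₁)) :=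
          ENNReal.ofReal_le_ofReal hreal
      _ = X₂ * A₁ := by
          rw [hX₂, hA₁, ← mul_assoc, ENNReal.ofReal_mul (mul_nonneg hX₁0 (by positivity)),
            ENNReal.ofReal_mul hX₁0]
  have hIut : Iu < ⊤ := lt_of_le_of_lt h2 (ENNReal.mul_lt_top hX₂t.lt_top ENNReal.ofReal_lt_top)
  -- ## (3) the `A`-gauge slice bound `∫_{B_a} |u(t)| ≤ Sc · (a³)^{1/2} (a^{1−2ρ})^{1/2}`
  set Sa : ℝ := (a ^ 3) ^ (1 / 2 : ℝ) * (a ^ (1 - 2 * ρ)) ^ (1 / 2 : ℝ) with hSa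
  have hSa0 : 0 ≤ Sa := by positivity
  have hd : Module.finrank ℝ (EuclideanSpace ℝ (Fin 3)) = 3 := by simp
  have hVa : volume (ball (0 : EuclideanSpace ℝ (Fin 3)) a) = ENNReal.ofReal (a ^ 3) * V₁ := by
    rw [Measure.addHaar_ball_of_pos volume _ ha0, hd]
  have hV2a : volume (ball (0 : EuclideanSpace ℝ (Fin 3)) (2 * a)) =
      ENNReal.ofReal 8 * ENNReal.ofReal (a ^ 3) * V₁ := by
    rw [Measure.addHaar_ball_of_pos volume _ h2a0, hd, ← ENNReal.ofReal_mul (by norm_num)]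
    congr 2; ring
  have hS : ∀ t ∈ W, ∫⁻ x in ball (0 : EuclideanSpace ℝ (Fin 3)) (2 * a / 2), ‖u t x‖ₑ ≤ Sc * ENNReal.ofReal Sa := by
    intro t ht
    rw [show 2 * a / 2 = a by ring]
    have htQ : t ∈ Ioo (-(a ^ 2)) 0 := ⟨lt_of_le_of_lt hα ht.1, lt_of_lt_of_le ht.2 hβ⟩
    have hsl := hAs a ha0 t htQ
    refine (setLIntegral_le_sqrt_mul_sqrt volume _ _).trans ?_
    rw [hVa]
    calc (∫⁻ x in ball (0 : EuclideanSpace ℝ (Fin 3)) a, ‖u t x‖ₑ ^ 2) ^ (1 / 2 : ℝ) *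
          (ENNReal.ofReal (a ^ 3) * V₁) ^ (1 / 2 : ℝ)
        ≤ ENNReal.ofReal ((c : ℝ) * a ^ (1 - 2 * ρ)) ^ (1 / 2 : ℝ) * (ENNReal.ofReal (a ^ 3) * V₁) ^ (1 / 2 : ℝ) := by
          gcongr
      _ = Sc * ENNReal.ofReal Sa := by
          rw [hSc, hSa, ENNReal.ofReal_mul (NNReal.coe_nonneg c),
            ENNReal.mul_rpow_of_nonneg _ _ (by norm_num : (0:ℝ) ≤ 1 / 2),
            ENNReal.mul_rpow_of_nonneg _ _ (by norm_num : (0:ℝ) ≤ 1 / 2),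
            ENNReal.ofReal_rpow_of_nonneg (Real.rpow_nonneg ha0.le _) (by norm_num : (0:ℝ) ≤ 1 / 2),
            ENNReal.ofReal_rpow_of_nonneg (pow_nonneg ha0.le 3) (by norm_num : (0:ℝ) ≤ 1 / 2),
            ENNReal.ofReal_mul (Real.rpow_nonneg (pow_nonneg ha0.le 3) _)]
          ring
  -- ## (4) the `D`-gauge: `∫∫_{W×B_{2a}} |p|^{3/2} ≤ c·4·a^{2−2ρ}`, and the `L¹` form
  set I32 : ℝ≥0∞ := ∫⁻ z in W ×ˢ ball (0 : EuclideanSpace ℝ (Fin 3)) (2 * a), ‖p z.1 z.2‖ₑ ^ (3 / 2 : ℝ) with hI32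
  have hWQ : W ×ˢ ball (0 : EuclideanSpace ℝ (Fin 3)) (2 * a) ⊆ parabolicCylinder (2 * a) (0 : ℝ × EuclideanSpace ℝ (Fin 3)) := by
    intro z hz
    simp only [parabolicCylinder, mem_prod, mem_Ioo, mem_ball, Prod.fst_zero, Prod.snd_zero, zero_sub] at hz ⊢
    exact ⟨⟨lt_of_le_of_lt hα2 hz.1.1, lt_of_lt_of_le hz.1.2 hβ⟩, mem_ball.1 hz.2⟩
  have h4 : I32 ≤ ENNReal.ofReal ((c : ℝ) * 4) * ENNReal.ofReal (a ^ (2 - 2 * ρ)) := by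
    have h1' := hD (2 * a) h2a0
    have hpos : 0 < (2 * a) ^ (2 * ρ) * ((2 * a) ^ 2)⁻¹ := by positivity
    have hcoef : ENNReal.ofReal ((2 * a) ^ (2 * ρ)) * (ENNReal.ofReal (2 * a) ^ 2)⁻¹ =
        ENNReal.ofReal ((2 * a) ^ (2 * ρ) * ((2 * a) ^ 2)⁻¹) := by
      rw [← ENNReal.ofReal_pow h2a0.le, ← ENNReal.ofReal_inv_of_pos (by positivity),
        ← ENNReal.ofReal_mul (Real.rpow_nonneg h2a0.le _)]
    unfold cknD at h1'
    rw [← mul_assoc, hcoef] at h1'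
    have h2' : ∫⁻ q in parabolicCylinder (2 * a) (0 : ℝ × EuclideanSpace ℝ (Fin 3)), ‖p q.1 q.2‖ₑ ^ (3 / 2 : ℝ) ≤
        (c : ℝ≥0∞) / ENNReal.ofReal ((2 * a) ^ (2 * ρ) * ((2 * a) ^ 2)⁻¹) := by
      rw [ENNReal.le_div_iff_mul_le (Or.inl ((ENNReal.ofReal_pos.2 hpos).ne')) (Or.inl ENNReal.ofReal_ne_top),
        mul_comm]
      exact h1'
    have hJ : ∫⁻ q in parabolicCylinder (2 * a) (0 : ℝ × EuclideanSpace ℝ (Fin 3)), ‖p q.1 q.2‖ₑ ^ (3 / 2 : ℝ) ≤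
        ENNReal.ofReal ((c : ℝ) * (2 * a) ^ (2 - 2 * ρ)) := by
      refine h2'.trans (le_of_eq ?_)
      rw [ENNReal.coe_nnreal_eq, ← ENNReal.ofReal_div_of_pos hpos]
      congr 1
      rw [div_eq_mul_inv, mul_inv, inv_inv, Real.rpow_sub h2a0, Real.rpow_two, div_eq_mul_inv]
      ring
    refine ((lintegral_mono_set hWQ).trans hJ).trans ?_
    rw [← ENNReal.ofReal_mul (by positivity)]
    refine ENNReal.ofReal_le_ofReal ?_
    rw [Real.mul_rpow (by norm_num) ha0.le, mul_assoc]
    refine mul_le_mul_of_nonneg_left (mul_le_mul_of_nonneg_right ?_ (Real.rpow_nonneg ha0.le _)) c.2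
    calc (2 : ℝ) ^ (2 - 2 * ρ) ≤ 2 ^ (2 : ℝ) := Real.rpow_le_rpow_of_exponent_le (by norm_num) (by linarith)
      _ = 4 := by norm_num
  have hI32t : I32 < ⊤ := lt_of_le_of_lt h4 (ENNReal.mul_lt_top ENNReal.ofReal_lt_top ENNReal.ofReal_lt_top)
  set Ip : ℝ≥0∞ := ∫⁻ z in W ×ˢ ball (0 : EuclideanSpace ℝ (Fin 3)) (2 * a), ‖p z.1 z.2‖ₑ with hIp
  set Pa : ℝ := (a ^ 3) ^ (1 / 3 : ℝ) * (a ^ (2 - 2 * ρ)) ^ (2 / 3 : ℝ) with hPa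
  have hPa0 : 0 ≤ Pa := by positivity
  have h5 : Ip ≤ X₄ * ENNReal.ofReal Pa := by
    set μ : Measure (ℝ × EuclideanSpace ℝ (Fin 3)) := volume.restrict (W ×ˢ ball (0 : EuclideanSpace ℝ (Fin 3)) (2 * a)) with hμ
    have hWs : W ×ˢ ball (0 : EuclideanSpace ℝ (Fin 3)) (2 * a) ⊆ Iio (0:ℝ) ×ˢ (univ : Set (EuclideanSpace ℝ (Fin 3))) :=
      prod_mono (fun s hs => lt_of_lt_of_le hs.2 hβ) (subset_univ _)
    have hp' : AEMeasurable (fun z : ℝ × EuclideanSpace ℝ (Fin 3) => ‖p z.1 z.2‖ₑ) μ :=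
      (hpm.mono_measure (Measure.restrict_mono hWs le_rfl)).aemeasurable.enorm
    have hpq : Real.HolderConjugate (3 / 2 : ℝ) 3 := ⟨by norm_num, by norm_num, by norm_num⟩
    have hH' := ENNReal.lintegral_mul_le_Lp_mul_Lq μ hpq hp' (aemeasurable_const (b := (1 : ℝ≥0∞)))
    simp only [Pi.mul_apply, mul_one, ENNReal.one_rpow, lintegral_const, one_mul] at hH'
    have hμu : μ univ = ENNReal.ofReal L * ENNReal.ofReal 8 * ENNReal.ofReal (a ^ 3) * V₁ := by
      rw [hμ, Measure.restrict_apply_univ, Measure.volume_eq_prod, Measure.prod_prod, Real.volume_Ioo, hV2a,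
        ← hLdef]
      ring
    refine hH'.trans ?_
    rw [hμu, show (1 / (3 / 2 : ℝ)) = 2 / 3 by norm_num]
    calc I32 ^ (2 / 3 : ℝ) * (ENNReal.ofReal L * ENNReal.ofReal 8 * ENNReal.ofReal (a ^ 3) * V₁) ^ (1 / (3 : ℝ))
        ≤ (ENNReal.ofReal ((c : ℝ) * 4) * ENNReal.ofReal (a ^ (2 - 2 * ρ))) ^ (2 / 3 : ℝ) *
            (ENNReal.ofReal L * ENNReal.ofReal 8 * ENNReal.ofReal (a ^ 3) * V₁) ^ (1 / (3 : ℝ)) := by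
          gcongr
      _ = X₄ * ENNReal.ofReal Pa := by
          rw [hX₄, hPa, show (1 / (3 : ℝ)) = 1 / 3 by norm_num,
            ENNReal.mul_rpow_of_nonneg _ _ (by norm_num : (0:ℝ) ≤ 2 / 3),
            show ENNReal.ofReal L * ENNReal.ofReal 8 * ENNReal.ofReal (a ^ 3) * V₁ =
              (ENNReal.ofReal L * ENNReal.ofReal 8 * V₁) * ENNReal.ofReal (a ^ 3) by ring,
            ENNReal.mul_rpow_of_nonneg _ _ (by norm_num : (0:ℝ) ≤ 1 / 3),
            ENNReal.ofReal_rpow_of_nonneg (Real.rpow_nonneg ha0.le _) (by norm_num : (0:ℝ) ≤ 2 / 3),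
            ENNReal.ofReal_rpow_of_nonneg (pow_nonneg ha0.le 3) (by norm_num : (0:ℝ) ≤ 1 / 3),
            ENNReal.ofReal_mul (Real.rpow_nonneg (pow_nonneg ha0.le 3) _)]
          ring
  -- ## (5) the window pressure bound at `r = 2a`
  have hP := hc₅ 0 u p (2 * a) α β (Sc * ENNReal.ofReal Sa) h2a0 hαβ hβ hsw.distributional hS hI32t hIut
  rw [show 2 * a / 2 = a by ring] at hP
  -- ## (6) folding the two pressure remainders into the cubic rate
  have hR : ENNReal.ofReal (((2 * a) ^ 3)⁻¹) ≤ ENNReal.ofReal ((a ^ 3)⁻¹) := by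
    refine ENNReal.ofReal_le_ofReal (inv_anti₀ (pow_pos ha0 3) ?_)
    gcongr; linarith
  have hB : ENNReal.ofReal ((a ^ 3)⁻¹) * (Sc * ENNReal.ofReal Sa) * (X₄ * ENNReal.ofReal Pa) ≤ Sc * X₄ * A₁ := by
    have e : ENNReal.ofReal ((a ^ 3)⁻¹) * (Sc * ENNReal.ofReal Sa) * (X₄ * ENNReal.ofReal Pa) =
        Sc * X₄ * (ENNReal.ofReal ((a ^ 3)⁻¹) * ENNReal.ofReal Sa * ENNReal.ofReal Pa) := by ring
    rw [e, ← ENNReal.ofReal_mul (inv_nonneg.2 (pow_nonneg ha0.le 3)), ← ENNReal.ofReal_mul (by positivity)]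
    refine mul_le_mul' le_rfl (ENNReal.ofReal_le_ofReal ?_)
    rw [hSa, hPa]
    exact rpow_harmonic_term_le ha hρ
  have hC : ENNReal.ofReal ((a ^ 3)⁻¹) * (Sc * ENNReal.ofReal Sa) *
      (ENNReal.ofReal (2 * a) * ENNReal.ofReal (β - α) ^ (1 / 3 : ℝ) * Iu ^ (2 / 3 : ℝ)) ≤ X₅ * A₁ := by
    have hIu23 : Iu ^ (2 / 3 : ℝ) ≤ X₂ ^ (2 / 3 : ℝ) * ENNReal.ofReal ((a ^ s₁) ^ (2 / 3 : ℝ)) := by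
      calc Iu ^ (2 / 3 : ℝ) ≤ (X₂ * A₁) ^ (2 / 3 : ℝ) := by gcongr
        _ = X₂ ^ (2 / 3 : ℝ) * ENNReal.ofReal ((a ^ s₁) ^ (2 / 3 : ℝ)) := by
            rw [ENNReal.mul_rpow_of_nonneg _ _ (by norm_num : (0:ℝ) ≤ 2 / 3), hA₁,
              ENNReal.ofReal_rpow_of_nonneg has₁ (by norm_num : (0:ℝ) ≤ 2 / 3)]
    rw [ENNReal.ofReal_mul (by norm_num : (0:ℝ) ≤ 2), ← hLdef]
    calc ENNReal.ofReal ((a ^ 3)⁻¹) * (Sc * ENNReal.ofReal Sa) *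
          (ENNReal.ofReal 2 * ENNReal.ofReal a * ENNReal.ofReal L ^ (1 / 3 : ℝ) * Iu ^ (2 / 3 : ℝ))
        ≤ ENNReal.ofReal ((a ^ 3)⁻¹) * (Sc * ENNReal.ofReal Sa) *
          (ENNReal.ofReal 2 * ENNReal.ofReal a * ENNReal.ofReal L ^ (1 / 3 : ℝ) *
            (X₂ ^ (2 / 3 : ℝ) * ENNReal.ofReal ((a ^ s₁) ^ (2 / 3 : ℝ)))) := by gcongr
      _ = X₅ * (ENNReal.ofReal ((a ^ 3)⁻¹) * ENNReal.ofReal Sa * ENNReal.ofReal a *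
            ENNReal.ofReal ((a ^ s₁) ^ (2 / 3 : ℝ))) := by rw [hX₅]; ring
      _ = X₅ * ENNReal.ofReal ((a ^ 3)⁻¹ * Sa * (a * (a ^ s₁) ^ (2 / 3 : ℝ))) := by
          rw [← ENNReal.ofReal_mul (inv_nonneg.2 (pow_nonneg ha0.le 3))]
          congr 1
          rw [ENNReal.ofReal_mul (mul_nonneg (inv_nonneg.2 (pow_nonneg ha0.le 3)) hSa0),
            ENNReal.ofReal_mul ha0.le]
          ring
      _ ≤ X₅ * A₁ := by
          refine mul_le_mul' le_rfl (ENNReal.ofReal_le_ofReal ?_)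
          rw [hSa]
          exact rpow_cubic_term_le ha hρ
  have hPle : ∫⁻ z in W ×ˢ ball (0 : EuclideanSpace ℝ (Fin 3)) a, ‖p z.1 z.2‖ₑ * ‖u z.1 z.2‖ₑ ≤
      (c₅ : ℝ≥0∞) * (X₂ + Sc * X₄ + X₅) * A₁ := by
    refine hP.trans ?_
    calc (c₅ : ℝ≥0∞) * (Iu + ENNReal.ofReal (((2 * a) ^ 3)⁻¹) * (Sc * ENNReal.ofReal Sa) *
            (Ip + ENNReal.ofReal (2 * a) * ENNReal.ofReal (β - α) ^ (1 / 3 : ℝ) * Iu ^ (2 / 3 : ℝ)))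
        ≤ (c₅ : ℝ≥0∞) * (X₂ * A₁ + ENNReal.ofReal ((a ^ 3)⁻¹) * (Sc * ENNReal.ofReal Sa) *
            (X₄ * ENNReal.ofReal Pa +
              ENNReal.ofReal (2 * a) * ENNReal.ofReal (β - α) ^ (1 / 3 : ℝ) * Iu ^ (2 / 3 : ℝ))) := by
          gcongr
      _ = (c₅ : ℝ≥0∞) * (X₂ * A₁ + (ENNReal.ofReal ((a ^ 3)⁻¹) * (Sc * ENNReal.ofReal Sa) * (X₄ * ENNReal.ofReal Pa) +
            ENNReal.ofReal ((a ^ 3)⁻¹) * (Sc * ENNReal.ofReal Sa) *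
              (ENNReal.ofReal (2 * a) * ENNReal.ofReal (β - α) ^ (1 / 3 : ℝ) * Iu ^ (2 / 3 : ℝ)))) := by
          rw [mul_add (ENNReal.ofReal ((a ^ 3)⁻¹) * (Sc * ENNReal.ofReal Sa))]
      _ ≤ (c₅ : ℝ≥0∞) * (X₂ * A₁ + (Sc * X₄ * A₁ + X₅ * A₁)) := by gcongr
      _ = (c₅ : ℝ≥0∞) * (X₂ + Sc * X₄ + X₅) * A₁ := by ring
  -- ## (7) assembly
  have hWs : W ×ˢ ball (0 : EuclideanSpace ℝ (Fin 3)) a ⊆ Iio (0:ℝ) ×ˢ (univ : Set (EuclideanSpace ℝ (Fin 3))) :=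
    prod_mono (fun s hs => lt_of_lt_of_le hs.2 hβ) (subset_univ _)
  have hmeas3 : AEMeasurable (fun z : ℝ × EuclideanSpace ℝ (Fin 3) => ‖u z.1 z.2‖ₑ ^ (3 : ℕ))
      (volume.restrict (W ×ˢ ball (0 : EuclideanSpace ℝ (Fin 3)) a)) :=
    ((hum.mono_measure (Measure.restrict_mono hWs le_rfl)).aemeasurable.enorm.pow_const _)
  have hΓA : Γ * A₁ = ENNReal.ofReal (Γ.toReal * a ^ s₁) := by
    rw [ENNReal.ofReal_mul ENNReal.toReal_nonneg, ENNReal.ofReal_toReal hΓt]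
  rw [← hΓA, lintegral_add_left' hmeas3, lintegral_const_mul' _ _ (by norm_num), hΓ, add_mul, mul_assoc (2 : ℝ≥0∞)]
  exact add_le_add h1 (mul_le_mul' le_rfl hPle)

end Summit.NavierStokesRegularity.NavierStokesRegularity.Theorems.PowerGaugeEulerLiouville

end
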